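import Literature.NumberTheory.Transcendental.RoySmallValueStep2Points
import Literature.NumberTheory.Transcendental.RoySmallValueStepsGlue
import Literature.NumberTheory.Transcendental.RoySmallValueOrbitsK
import HarnessLib

/-!
# Roy's small value estimate for `𝔾ₐ × 𝔾ₘ` — §7 Step 2, conclusion: the distance sum over the selected orbit

Topic `Literature/NumberTheory/Transcendental`. Part of the formalisation of the proof of Roy 2013,
Theorem 1.1 (named fact `roy2013_thm_1_1`, `RoySmallValueEstimates.lean`), seat B. Source: D. Roy,
*A small value estimate for `𝔾ₐ × 𝔾ₘ`*, Mathematika 59 (2013) 333–363 = arXiv:1301.0663, §7,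
Step 2 (p. 18 of the arXiv text):

> Putting all these estimates together, taking into account that `Z(ℂ)` consists of `deg(Z)`
> points, we conclude that
> `∑_{α∈𝒰} max{T log dist(α,(1:γ)), log dist(α,A_γ)} ≤ ∑_{α∈Z} log|I_D^{(γ,T)}|_α + 7T(log T)² deg(Z) ≤ −(D^δ/25)(D^β deg(Z) + D h(Z))`.

For the orbit `O` selected in `RoySmallValueStep2Orbit` (product bound
`∏_{j∈O} (|R_j(α_j)|/‖α_j‖^D · E_j) ≤ M` for all families of elements of `𝒞`) we choose, point by
point, the tests of `RoySmallValueStep2Points` at the sup-normalised representatives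
`u_j = α_j/‖α_j‖` and obtain (`ZeroConfigK.step2_distance_sum`)

  `∑_{j∈O, u_j∈𝒰} max{T log d₁(u_j), log⁎ d₂(u_j)} ≤ log M − ∑_{j∈O} log E_j − Y·#O + Γ''·#O`,

`Γ'' = max{Γ, log(2^TΛ^k) − T log((2c₂)⁻¹)}` the junk constant (Roy's `7T(log T)²`), via
`sum_filter_le_sum_add` (`RoySmallValueStepsGlue`). Also: the sup-normalisation lemmas
`norm_eval_supNormalise`, `supNormalise_le_one`, `exists_one_le_supNormalise`. Everything is
proved; the one definition `supNormalise` has a body; no named facts.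

## References

* [Roy2013] D. Roy, *A small value estimate for 𝔾ₐ × 𝔾ₘ*, Mathematika 59 (2013), 333–363
  (arXiv:1301.0663), §7, Step 2 (last display before "In particular").
-/

noncomputable section

open MvPolynomial Finset

namespace Literature.NumberTheory.Transcendental

namespace Roy2013

/-! ### Sup-normalised representatives -/

/-- The sup-normalised representative `α/‖α‖`. [cite: Roy2013, §7, Step 2 ("representatives … of norm 1")] -/
def supNormalise (α : Fin 3 → ℂ) : Fin 3 → ℂ := ((‖α‖⁻¹ : ℝ) : ℂ) • α

/-- `‖α/‖α‖‖ = 1`. [folklore] -/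
theorem norm_supNormalise {α : Fin 3 → ℂ} (hα : α ≠ 0) : ‖supNormalise α‖ = 1 := by
  rw [supNormalise, norm_smul, Complex.norm_real, Real.norm_eq_abs, abs_inv, abs_norm,
    inv_mul_cancel₀ (norm_ne_zero_iff.mpr hα)]

/-- All coordinates of `α/‖α‖` have modulus `≤ 1`. [folklore] -/
theorem supNormalise_le_one {α : Fin 3 → ℂ} (hα : α ≠ 0) (i : Fin 3) : ‖supNormalise α i‖ ≤ 1 := by
  rw [← norm_supNormalise hα]; exact norm_le_pi_norm _ i

/-- Some coordinate of `α/‖α‖` has modulus `1`. [folklore] -/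
theorem exists_one_le_supNormalise {α : Fin 3 → ℂ} (hα : α ≠ 0) : ∃ i, 1 ≤ ‖supNormalise α i‖ := by
  obtain ⟨k, -, hk⟩ := Finset.exists_mem_eq_sup (univ : Finset (Fin 3)) univ_nonempty
    (fun k => ‖supNormalise α k‖₊)
  refine ⟨k, le_of_eq ?_⟩
  rw [← norm_supNormalise hα, Pi.norm_def, hk, coe_nnnorm]

/-- **`|R(α/‖α‖)| = |R(α)|/‖α‖^D`** for a form `R` of degree `D`. [folklore] -/
theorem norm_eval_supNormalise {R : CX} {D : ℕ} (hR : R.IsHomogeneous D) (α : Fin 3 → ℂ) :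
    ‖eval (supNormalise α) R‖ = ‖eval α R‖ / ‖α‖ ^ D := by
  have h := aeval_smul_of_isHomogeneous hR (((‖α‖⁻¹ : ℝ) : ℂ)) α
  change eval (supNormalise α) R = _ * eval α R at h
  rw [h, norm_mul, norm_pow, Complex.norm_real, Real.norm_eq_abs, abs_inv, abs_norm, inv_pow,
    mul_comm, div_eq_mul_inv]

/-! ### The distance sum over the selected orbit -/

namespace ZeroConfigK

variable {K : IntermediateField ℚ ℂ} {ι : Type*} [Fintype ι] [DecidableEq ι] (Z : ZeroConfigK K ι)
  [NumberField K]

/-- **Roy 2013, §7 Step 2, "putting all these estimates together"** for the selected orbit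
`O = orb i₀`: see the module docstring. `hO` is the product bound of the orbit selection,
`log⁎ d₂ = log d₂` if `d₂ > 0`, else `T log d₁`. [cite: Roy2013, §7, Step 2] -/
theorem step2_distance_sum (i₀ : ι) {ξ η : ℂ} (hη : η ≠ 0) {L T D k : ℕ}
    (hT₁ : (L + 1).choose 2 < T) (hT₂ : T ≤ (L + 2).choose 2) (hD : 3 * (L + 1) ≤ D) (hDT : D ≤ T)
    (hk : 2 ^ k * T ≤ 3 ^ k * D) (Y U : ℝ) {E : ι → ℝ} (hE : ∀ j, 0 < E j) {M : ℝ}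
    (hO : ∀ t : ι → CX, (∀ j ∈ Z.orb i₀, t j ∈ royBody D ξ η Y U T) →
      ∏ j ∈ Z.orb i₀, (‖eval (Z.α j) (t j)‖ / ‖Z.α j‖ ^ D * E j) ≤ M)
    (hd₁ : ∀ j ∈ Z.orb i₀, 0 < pdist ξ η (supNormalise (Z.α j))) :
    ∑ j ∈ (Z.orb i₀).filter (fun j => pdist ξ η (supNormalise (Z.α j)) ≤ (2 * roy_c2 ξ η)⁻¹),
        max (T * Real.log (pdist ξ η (supNormalise (Z.α j))))
          (if 0 < adist ξ η (supNormalise (Z.α j)) then Real.log (adist ξ η (supNormalise (Z.α j)))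
            else T * Real.log (pdist ξ η (supNormalise (Z.α j)))) ≤
      Real.log M - ∑ j ∈ Z.orb i₀, Real.log (E j) - Y * (Z.orb i₀).card +
        max ((max (Real.log (2 ^ T * (3 * (3 * (1 + ‖ξ‖ + ‖η‖⁻¹) * max 1 (max ‖ξ‖ ‖η‖)) ^ T *
              (16 * (T : ℝ) ^ 3) ^ T) ^ k))
            (Real.log (2 * ((2 * roy_c2 ξ η) ^ T * (1 + roy_c2 ξ η * Real.exp (1 + roy_c2 ξ η)) *
              (3 * (3 * (1 + ‖ξ‖ + ‖η‖⁻¹) * max 1 (max ‖ξ‖ ‖η‖)) ^ T *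
                (16 * (T : ℝ) ^ 3) ^ T) ^ k))) +
          |Real.log (2 * (roy_c2 ξ η * Real.exp (roy_c2 ξ η) * (2 * roy_c2 ξ η ^ 2) ^ T))|))
          (Real.log (2 ^ T * (3 * (3 * (1 + ‖ξ‖ + ‖η‖⁻¹) * max 1 (max ‖ξ‖ ‖η‖)) ^ T *
              (16 * (T : ℝ) ^ 3) ^ T) ^ k) - T * Real.log ((2 * roy_c2 ξ η)⁻¹)) *
          (Z.orb i₀).card := by
  classical
  -- abbreviations for the constants
  obtain ⟨Γ, hΓ⟩ : ∃ Γ : ℝ, Γ = max (Real.log (2 ^ T * (3 * (3 * (1 + ‖ξ‖ + ‖η‖⁻¹) * max 1 (max ‖ξ‖ ‖η‖)) ^ T *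
              (16 * (T : ℝ) ^ 3) ^ T) ^ k))
            (Real.log (2 * ((2 * roy_c2 ξ η) ^ T * (1 + roy_c2 ξ η * Real.exp (1 + roy_c2 ξ η)) *
              (3 * (3 * (1 + ‖ξ‖ + ‖η‖⁻¹) * max 1 (max ‖ξ‖ ‖η‖)) ^ T *
                (16 * (T : ℝ) ^ 3) ^ T) ^ k))) +
          |Real.log (2 * (roy_c2 ξ η * Real.exp (roy_c2 ξ η) * (2 * roy_c2 ξ η ^ 2) ^ T))| := ⟨_, rfl⟩
  obtain ⟨Γf, hΓf⟩ : ∃ Γf : ℝ, Γf = Real.log (2 ^ T * (3 * (3 * (1 + ‖ξ‖ + ‖η‖⁻¹) * max 1 (max ‖ξ‖ ‖η‖)) ^ T *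
              (16 * (T : ℝ) ^ 3) ^ T) ^ k) - T * Real.log ((2 * roy_c2 ξ η)⁻¹) := ⟨_, rfl⟩
  rw [← hΓ, ← hΓf]
  obtain ⟨u, hu⟩ : ∃ u : ι → Fin 3 → ℂ, u = fun j => supNormalise (Z.α j) := ⟨_, rfl⟩
  have huj : ∀ j, supNormalise (Z.α j) = u j := fun j => by rw [hu]
  simp only [huj] at hd₁ ⊢
  have hule : ∀ j i, ‖u j i‖ ≤ 1 := fun j i => by rw [hu]; exact supNormalise_le_one (Z.α_ne_zero j) i
  have hu1 : ∀ j, ∃ i, 1 ≤ ‖u j i‖ := fun j => by rw [hu]; exact exists_one_le_supNormalise (Z.α_ne_zero j)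
  -- choose the tests point by point
  have htest : ∀ j ∈ Z.orb i₀, ∃ R ∈ royBody D ξ η Y U T, 0 < ‖eval (u j) R‖ ∧
      (pdist ξ η (u j) ≤ (2 * roy_c2 ξ η)⁻¹ →
        Y + max (T * Real.log (pdist ξ η (u j)))
          (if 0 < adist ξ η (u j) then Real.log (adist ξ η (u j)) else T * Real.log (pdist ξ η (u j))) ≤
          Γ + Real.log ‖eval (u j) R‖) ∧
      ((2 * roy_c2 ξ η)⁻¹ < pdist ξ η (u j) →
        Y + T * Real.log ((2 * roy_c2 ξ η)⁻¹) ≤ Γf + T * Real.log ((2 * roy_c2 ξ η)⁻¹) +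
          Real.log ‖eval (u j) R‖) := by
    intro j hj
    by_cases hnear : pdist ξ η (u j) ≤ (2 * roy_c2 ξ η)⁻¹
    · obtain ⟨R, hR, hpos, hle⟩ := exists_test_near hη hT₁ hT₂ hD hDT hk (hule j) (hu1 j) (hd₁ j hj)
        hnear Y U
      refine ⟨R, hR, hpos, fun _ => ?_, fun hfar => absurd hnear (not_le.mpr hfar)⟩
      rw [hΓ]; exact hle
    · push Not at hnear
      obtain ⟨R, hR, hpos, hle⟩ := exists_test_far hη hT₁ hT₂ hD hDT hk (hule j) hnear Y U
      refine ⟨R, hR, hpos, fun hn => absurd hn (not_le.mpr hnear), fun _ => ?_⟩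
      rw [hΓf]; linarith
  choose! t ht_mem ht_pos ht_near ht_far using htest
  -- the product bound for this family, in logarithmic form
  have hval : ∀ j ∈ Z.orb i₀, ‖eval (Z.α j) (t j)‖ / ‖Z.α j‖ ^ D = ‖eval (u j) (t j)‖ := by
    intro j hj
    rw [hu, norm_eval_supNormalise (ht_mem j hj).1 (Z.α j)]
  have hB := hO t ht_mem
  rw [Finset.prod_congr rfl fun j hj => by rw [hval j hj]] at hB
  have hfacpos : ∀ j ∈ Z.orb i₀, 0 < ‖eval (u j) (t j)‖ * E j := fun j hj =>
    mul_pos (ht_pos j hj) (hE j)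
  have hlog := Real.log_le_log (prod_pos hfacpos) hB
  rw [Real.log_prod (s := Z.orb i₀) (fun j hj => (hfacpos j hj).ne')] at hlog
  have hsplit : ∑ j ∈ Z.orb i₀, Real.log (‖eval (u j) (t j)‖ * E j) =
      ∑ j ∈ Z.orb i₀, Real.log ‖eval (u j) (t j)‖ + ∑ j ∈ Z.orb i₀, Real.log (E j) := by
    rw [← sum_add_distrib]
    exact Finset.sum_congr rfl fun j hj => Real.log_mul (ht_pos j hj).ne' (hE j).ne'
  rw [hsplit] at hlog
  -- `sum_filter_le_sum_add` with `f j = log|R_j(u_j)| − Y`, `E' = max Γ Γf`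
  have hmain := sum_filter_le_sum_add (Z.orb i₀) (fun j => pdist ξ η (u j) ≤ (2 * roy_c2 ξ η)⁻¹)
    (fun j => Real.log ‖eval (u j) (t j)‖ - Y)
    (fun j => max (T * Real.log (pdist ξ η (u j)))
      (if 0 < adist ξ η (u j) then Real.log (adist ξ η (u j)) else T * Real.log (pdist ξ η (u j))))
    (max Γ Γf)
    (fun j hj hp => by
      have := ht_near j hj hp
      linarith [le_max_left Γ Γf])
    (fun j hj hp => by
      have := ht_far j hj (not_le.mp hp)
      linarith [le_max_right Γ Γf])
  rw [sum_sub_distrib, sum_const, nsmul_eq_mul] at hmain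
  linarith

end ZeroConfigK

end Roy2013

end Literature.NumberTheory.Transcendental
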